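import Literature.GroupTheory.CombinatorialGroupTheory.ConjugacySeparable
import Literature.GroupTheory.CombinatorialGroupTheory.SurfaceAmalgamEllipticPairs
import Literature.GroupTheory.CombinatorialGroupTheory.AmalgamNormalForm
import Literature.GroupTheory.CombinatorialGroupTheory.CyclicAmalgamMixedPairs
import Literature.GroupTheory.CombinatorialGroupTheory.CyclicAmalgamHyperbolicPairs
import HarnessLib

/-!
# Orientable surface groups are conjugacy separable (Stebe 1972, Thm. 3.3) — PROOF of the named fact

Topic `Literature/GroupTheory/CombinatorialGroupTheory`; theorems only.  This file DISCHARGES the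
tree's named fact `SurfaceGroupConjugacySeparable` (`SurfaceGroupConjugacySeparable.lean`; P. F. Stebe,
*Conjugacy separability of certain Fuchsian groups*, Trans. Amer. Math. Soc. 163 (1972) 173–188,
Theorem 3.3 p. 182: the groups `Gₙ = ⟨a₁, …, aₙ, b₁, …, bₙ ; (a₁, b₁) ⋯ (aₙ, bₙ) = 1⟩`, `n ≥ 2`, are
conjugacy separable), the external input "[Stb2], Theorem 3.3" of S. Mochizuki, IUTchI, proof of
Theorem 2.6 (kurims p. 57), by assembling the tree's bricks along the finite-quotient route of
J. L. Dyer, *Separating conjugates in amalgamated free products and HNN extensions*, J. Austral. Math.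
Soc. (A) 29 (1980), Thm. 10 p. 48 (`A`, `B` free, `H` cyclic ⇒ `(A * B : H)` conjugacy separable)
for the splitting `Sₙ ≅ F_{2(n-1)} *_ℤ F_2` (the tree's `exists_surfaceGroup_mulEquiv_surfaceAmalgam`,
Lyndon–Schupp I.7 / Serre, *Trees*, I.1.2).

* `surfaceAmalgam_exists_normal_finiteIndex_not_isConj` — for `g, h ≥ 1`, two non-conjugate elements
  of `F_{2g} *_ℤ F_{2h}` have non-conjugate images in some finite quotient.  Proof: bring both to
  conjugacy normal form (`Amalgam.exists_conj_normalForm`, MKS Thm. 4.6: a base element, a single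
  letter, or a cyclically reduced word of length `≥ 2`) and split —
  (E) both elliptic: `surfaceAmalgam_exists_hom_finite_not_isConj_of_short` (the tree's
  `SurfaceAmalgamEllipticPairs`, wreath-product device);
  (M) one elliptic, one cyclically reduced of length `≥ 2`:
  `CyclicAmalgam.exists_normal_finiteIndex_not_isConj_elliptic_hyperbolic` (the tree's
  `CyclicAmalgamMixedPairs`: finite vs. infinite order in a synchronised finite-factor quotient);
  (H) both cyclically reduced of length `≥ 2`: `CyclicAmalgam.exists_normal_finiteIndex_not_isConj_hyperbolic`
  (the tree's `CyclicAmalgamHyperbolicPairs`: Dyer's Case 3 transfer to a finite-factor quotient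
  amalgam, then "finite amalgams are free-by-finite" and the conjugacy distinguishedness of elements of
  infinite order in free-by-finite groups), which needs the MALNORMALITY of the amalgamated `ℤ` in
  each free factor (`surfaceAmalgam_malnormal`: the surface relator is not a proper power).
* `surfaceGroupConjugacySeparable_holds : SurfaceGroupConjugacySeparable` — **Stebe's theorem**,
  transported along `Sₙ ≃* F_{2(n-1)} *_ℤ F_2`;
  `isConjugacySeparable_surfaceGroup` — the same in the predicate form `IsConjugacySeparable (Sₙ)`.

Honest scope: orientable closed surface groups of genus `≥ 2` only (Stebe's Thm. 3.3); Fuchsian groups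
with torsion, non-orientable surface groups and LERF are not touched.  Classical; nothing here concerns
the disputed parts of inter-universal Teichmüller theory (the consumer, [IUTchI] Thm. 2.6, merely cites
the theorem).

## References

* P. F. Stebe, *Conjugacy separability of certain Fuchsian groups*, Trans. Amer. Math. Soc. 163
  (1972) 173–188, Thm. 3.3 p. 182. [Stebe1972]
* J. L. Dyer, *Separating conjugates in amalgamated free products and HNN extensions*, J. Austral.
  Math. Soc. Ser. A 29 (1980) 35–51, Thm. 10 p. 48, proof of Thm. 4 p. 40. [Dyer1980]
* W. Magnus, A. Karrass, D. Solitar, *Combinatorial Group Theory*, Interscience (1966), §4.2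
  Thm. 4.6. [MagnusKarrassSolitar1966]
-/

namespace Literature.GroupTheory.CombinatorialGroupTheory

open Literature.Topology.FourManifolds Monoid Monoid.PushoutI Function

variable {g h : ℕ}

/-! ### The surface amalgam `F_{2g} *_ℤ F_{2h}` -/

/-- **Non-conjugate elements of `F_{2g} *_ℤ F_{2h}` (`g, h ≥ 1`) are separated in a finite quotient**
(Dyer 1980 Thm. 10 for this amalgam, assembled from the tree's bricks by the conjugacy normal form:
elliptic/elliptic, elliptic/hyperbolic, hyperbolic/hyperbolic). [cite: Dyer1980, Thm. 10 p.48] -/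
theorem surfaceAmalgam_exists_normal_finiteIndex_not_isConj (hg : 1 ≤ g) (hh : 1 ≤ h)
    {x y : SurfaceAmalgam g h} (hxy : ¬ IsConj x y) :
    ∃ (N : Subgroup (SurfaceAmalgam g h)) (_ : N.Normal) (_ : N.FiniteIndex),
      ¬ IsConj (QuotientGroup.mk x : SurfaceAmalgam g h ⧸ N) (QuotientGroup.mk y) := by
  have hφ := surfaceAmalgamHom_injective hg hh
  have hmal : ∀ (b : Bool) (u : SurfaceAmalgamFactor g h b), u ∉ (surfaceAmalgamHom g h b).range →
      ∀ c : Multiplicative ℤ, u * surfaceAmalgamHom g h b c * u⁻¹ ∈ (surfaceAmalgamHom g h b).range →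
        c = 1 :=
    fun b u hu c hc => surfaceAmalgam_malnormal hg hh b u hu c hc
  -- finite-quotient form from the homomorphism form of the elliptic brick
  have short : ∀ {x y : SurfaceAmalgam g h},
      (∃ p : SurfaceAmalgam g h, (∃ c, p * x * p⁻¹ = base (surfaceAmalgamHom g h) c) ∨
        (∃ (b : Bool) (u : SurfaceAmalgamFactor g h b), p * x * p⁻¹ = of b u)) →
      (∃ p : SurfaceAmalgam g h, (∃ c, p * y * p⁻¹ = base (surfaceAmalgamHom g h) c) ∨
        (∃ (b : Bool) (u : SurfaceAmalgamFactor g h b), p * y * p⁻¹ = of b u)) →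
      ¬ IsConj x y →
      ∃ (N : Subgroup (SurfaceAmalgam g h)) (_ : N.Normal) (_ : N.FiniteIndex),
        ¬ IsConj (QuotientGroup.mk x : SurfaceAmalgam g h ⧸ N) (QuotientGroup.mk y) := by
    intro x y hx hy hxy
    obtain ⟨Q, _, _, f, hf⟩ := surfaceAmalgam_exists_hom_finite_not_isConj_of_short hg hh hx hy hxy
    haveI : Finite (SurfaceAmalgam g h ⧸ f.ker) :=
      Finite.of_injective _ (QuotientGroup.kerLift_injective f)
    refine ⟨f.ker, inferInstance, Subgroup.finiteIndex_of_finite_quotient, fun hc => hf ?_⟩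
    simpa using (QuotientGroup.kerLift f).map_isConj hc
  -- the elliptic normal forms (a)/(b) in the shape the bricks consume
  have ell : ∀ {z : SurfaceAmalgam g h} {p : SurfaceAmalgam g h},
      ((∃ c, p * z * p⁻¹ = base (surfaceAmalgamHom g h) c) ∨
        (∃ (b : Bool) (u : SurfaceAmalgamFactor g h b),
          (∀ a : SurfaceAmalgamFactor g h b, a * u * a⁻¹ ∉ (surfaceAmalgamHom g h b).range) ∧
            p * z * p⁻¹ = of b u)) →
      ∃ p : SurfaceAmalgam g h, (∃ c, p * z * p⁻¹ = base (surfaceAmalgamHom g h) c) ∨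
        (∃ (b : Bool) (u : SurfaceAmalgamFactor g h b), p * z * p⁻¹ = of b u) := by
    rintro z p (hc | ⟨b, u, -, hu⟩)
    · exact ⟨p, Or.inl hc⟩
    · exact ⟨p, Or.inr ⟨b, u, hu⟩⟩
  -- conjugacy normal forms
  obtain ⟨p, hx⟩ := Amalgam.exists_conj_normalForm hφ x
  obtain ⟨p', hy⟩ := Amalgam.exists_conj_normalForm hφ y
  rcases hx with hxa | hxb | ⟨w, hwc, hwr, hw2, hwcr, hxw⟩ <;>
    rcases hy with hya | hyb | ⟨w', hw'c, hw'r, hw'2, hw'cr, hyw⟩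
  -- (E) both elliptic
  · exact short (ell (Or.inl hxa)) (ell (Or.inl hya)) hxy
  · exact short (ell (Or.inl hxa)) (ell (Or.inr hyb)) hxy
  -- (M) elliptic / hyperbolic
  · exact CyclicAmalgam.exists_normal_finiteIndex_not_isConj_elliptic_hyperbolic
      (surfaceAmalgamHom g h) hφ (ell (Or.inl hxa)) hw'c hw'r hw'2 hw'cr ⟨p', hyw⟩
  · exact short (ell (Or.inr hxb)) (ell (Or.inl hya)) hxy
  · exact short (ell (Or.inr hxb)) (ell (Or.inr hyb)) hxy
  · exact CyclicAmalgam.exists_normal_finiteIndex_not_isConj_elliptic_hyperbolic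
      (surfaceAmalgamHom g h) hφ (ell (Or.inr hxb)) hw'c hw'r hw'2 hw'cr ⟨p', hyw⟩
  -- (M) hyperbolic / elliptic
  · exact CyclicAmalgam.exists_normal_finiteIndex_not_isConj_hyperbolic_elliptic
      (surfaceAmalgamHom g h) hφ hwc hwr hw2 hwcr ⟨p, hxw⟩ (ell (Or.inl hya))
  · exact CyclicAmalgam.exists_normal_finiteIndex_not_isConj_hyperbolic_elliptic
      (surfaceAmalgamHom g h) hφ hwc hwr hw2 hwcr ⟨p, hxw⟩ (ell (Or.inr hyb))
  -- (H) both hyperbolic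
  · exact CyclicAmalgam.exists_normal_finiteIndex_not_isConj_hyperbolic (surfaceAmalgamHom g h) hφ
      hmal hwc hwr hw2 hwcr hw'c hw'r hw'2 hw'cr ⟨p, hxw⟩ ⟨p', hyw⟩ hxy

/-! ### Stebe's theorem -/

/-- **Stebe's theorem: orientable surface groups of genus `≥ 2` are conjugacy separable**
(Trans. AMS 163 (1972), Thm. 3.3 p. 182) — PROOF of the tree's named fact
`SurfaceGroupConjugacySeparable`: for `n ≥ 2` and non-conjugate `u, v ∈ Sₙ` there is a normal
subgroup `L ⊴ Sₙ` of finite index with `ū ≁ v̄` in `Sₙ ⧸ L`.  Via `Sₙ ≅ F_{2(n-1)} *_ℤ F_2` and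
`surfaceAmalgam_exists_normal_finiteIndex_not_isConj`. [cite: Stebe1972, Thm 3.3 p.182] -/
theorem surfaceGroupConjugacySeparable_holds :
    Literature.GroupTheory.CombinatorialGroupTheory.SurfaceGroupConjugacySeparable := by
  intro n hn u v huv
  obtain ⟨m, rfl⟩ : ∃ m, n = m + 1 := ⟨n - 1, by omega⟩
  have hm : 1 ≤ m := by omega
  obtain ⟨e, -, -⟩ := exists_surfaceGroup_mulEquiv_surfaceAmalgam m 1
  have huv' : ¬ IsConj (e u) (e v) := fun hc =>
    huv (by simpa using e.symm.toMonoidHom.map_isConj hc)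
  exact exists_normal_finiteIndex_not_isConj_of_monoidHom e.toMonoidHom
    (surfaceAmalgam_exists_normal_finiteIndex_not_isConj hm le_rfl huv')

/-- `SurfaceGroupConjugacySeparable` — `_holds` alias of `surfaceGroupConjugacySeparable_holds` above under the fact's exact name (appended
2026-08-28, D-0026 bookkeeping: the proof term is the existing theorem of this file; no statement,
definition or attribute is edited; no new named fact; the ledger's debt table listed the fact
unproved). [cite: Stebe1972, Thm 3.3 p.182] -/
theorem _root_.Literature.GroupTheory.CombinatorialGroupTheory.SurfaceGroupConjugacySeparable_holds :
    Literature.GroupTheory.CombinatorialGroupTheory.SurfaceGroupConjugacySeparable :=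
  _root_.Literature.GroupTheory.CombinatorialGroupTheory.surfaceGroupConjugacySeparable_holds

/-- **Orientable surface groups are conjugacy separable**, predicate form: `IsConjugacySeparable (Sₙ)`
for every `n ≥ 2` (Stebe's own phrasing, Trans. AMS 163 (1972) p. 173 / Thm. 3.3 p. 182).
[cite: Stebe1972, Thm 3.3 p.182] -/
theorem isConjugacySeparable_surfaceGroup {n : ℕ} (hn : 2 ≤ n) :
    IsConjugacySeparable (SurfaceGroup n) :=
  isConjugacySeparable_surfaceGroup_of_fact surfaceGroupConjugacySeparable_holds hn

end Literature.GroupTheory.CombinatorialGroupTheory
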